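import Mathlib
import Summits.NavierStokesRegularity.NavierStokesRegularity.Theorems.LerayQuarterDissipationFiniteDissipationLiouvilleWindowBlobProduction
import Summits.NavierStokesRegularity.NavierStokesRegularity.Theorems.LocalLambTubeDoorGeneralisedBeltramiProfileRigidity
import Literature.Analysis.FluidPDE.TypeIAncientMildTimeAnalytic
import Literature.Analysis.FluidPDE.SpaceTimeCalculus
import HarnessLib

/-!
# Crux `FiniteDissipationLiouville` (stmt-NavierStokesRegularity-22144): THE CALORIC DEFECT OF THE VORTICITY, I —
# the curl of the Lamb vector `(W·∇)ω − (ω·∇)W = −(∂ₜ − Δ)ω` of a member of the class is jointly real-analytic, and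
# a member on which it vanishes on a final slab, or on any open space–time set, is identically zero

Theorems file of route `LerayQuarterDissipation` (lead prover g20; `--supports` the crux; file 1/2 of the g20 axis, sequel
`…CaloricDefectWindows`). Navier–Stokes regularity is NOT proved by anything here; no summit is.

The vorticity equation of a member `W` of the KNSS-gauge Type-I class reads `∂ₜω − Δω = (ω·∇)W − (W·∇)ω = −curl(ω × W)`
(`ω = curl W`). The locus `curl(ω × W) ≡ 0` — GENERALISED BELTRAMI flows, whose Lamb vector is locally a gradient and
whose vorticity is CALORIC — carries a pointwise Liouville theorem already in the tree (cell ns-regularity-ideate,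
`…LocalLambTubeDoorGeneralisedBeltramiProfileRigidity.eq_zero_of_convect_comm`: on the whole past the vorticity is a
bounded ancient caloric field, hence constant, hence zero). This file prepares the kill for the crux's sockets:

* `analyticOnNhd_uncurry_fderiv_of_smooth` (tool) — for a jointly smooth, jointly real-analytic space–time field on
  the open past, the slice-gradient field `(t, x) ↦ D(w t)(x)` is again jointly real-analytic; hence
  `analyticOnNhd_uncurry_curl`, `analyticOnNhd_uncurry_fderiv_curl` and **`analyticOnNhd_uncurry_lambCurl`: the
  commutator `(t, x) ↦ D(curl W t)(x)[W t x] − D(W t)(x)[curl W t x]` of a member of the class is jointly real-analytic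
  on `(−∞, 0) × ℝ³`** (Lemarié-Rieusset's space–time analyticity, Literature `IsTypeIAncientMild.analyticAt_uncurry`),
  and real-analytic in time at each fixed point (`analyticOnNhd_lambCurl_time`);
* `lambCurl_eq_zero_of_finalSlab`, `lambCurl_eq_zero_of_isOpen` — if the commutator vanishes on a final slab
  `(τ₀, 0) × ℝ³`, or merely on a nonempty open space–time set, it vanishes on the whole past (identity theorem);
  **`eq_zero_of_lambCurl_finalSlab` / `eq_zero_of_lambCurl_isOpen`: such a member is identically zero** (the tree's
  generalised-Beltrami rigidity, imported by name); `not_singular_of_lambCurlBound_finalSlab` is the apex form used by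
  the blob socket (`t²‖comm‖ ≤ 0` on `(−1, 0) × ℝ³` ⇒ not singular);
* `lambCurl_nsRescale`, `lambCurlBound_at_nsRescale`, `sq_mul_norm_lambCurl_nsRescale` — scale covariance
  `comm(W_c)(s, y) = c⁴ • comm(W)(c²s, cy)`: the size `t²‖comm‖` is dimensionless.

Fluid-mechanical reading: in the class, the transport of vorticity balances its stretching on an open space–time set
only for the zero field; equivalently the vorticity is nowhere locally caloric and the Lamb vector `ω × W` nowhere
locally a gradient, unless `W ≡ 0`.

HONEST FRAMING. Plumbing (analyticity of derived jets) around a kill that was already in the tree, about a HYPOTHETICAL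
object; nothing is removed from the DSS wall (`∀ c>1 TypeIDSSLiouville c`, NECESSARY for the crux by `…Hardness`); the
verdict of the line is unchanged (FRONTIER). Nothing here bears on Navier–Stokes regularity.

References: Koch–Nadirashvili–Seregin–Šverák, Acta Math. 203 (2009) §4 (the class); P. G. Lemarié-Rieusset, The
Navier–Stokes problem in the 21st century (2016), Thm 9.12 (space–time analyticity); folklore (generalised Beltrami
flows: the vorticity equation is the heat equation).
-/

noncomputable section

set_option linter.dupNamespace false

namespace Summit.NavierStokesRegularity.NavierStokesRegularity.Theorems.FiniteDissipationLiouville.CaloricDefect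

open MeasureTheory Set Filter Topology Metric InnerProductSpace Function Real
open scoped RealInnerProductSpace ContDiff ENNReal
open Literature.Analysis Literature.Analysis.FluidPDE
open Summit.NavierStokesRegularity.NavierStokesRegularity.Theorems
open Summit.NavierStokesRegularity.NavierStokesRegularity.Theorems.RecurrentReductionD
open Summit.NavierStokesRegularity.NavierStokesRegularity.Theorems.FiniteDissipationLiouville
open Summit.NavierStokesRegularity.NavierStokesRegularity.Theorems.FiniteDissipationLiouville.CrossFlow
open Summit.NavierStokesRegularity.NavierStokesRegularity.Theorems.FiniteDissipationLiouville.EndpointScheme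
open Summit.NavierStokesRegularity.NavierStokesRegularity.Theorems.FiniteDissipationLiouville.WindowSocket
open Summit.NavierStokesRegularity.NavierStokesRegularity.Theorems.FiniteDissipationLiouville.WindowRecurrence
open Summit.NavierStokesRegularity.NavierStokesRegularity.Theorems.FiniteDissipationLiouville.Compactness
open Summit.NavierStokesRegularity.NavierStokesRegularity.Theorems.LocalLambTubeDoorGeneralisedBeltramiProfileRigidity

variable {C : ℝ} {W : ℝ → EuclideanSpace ℝ (Fin 3) → EuclideanSpace ℝ (Fin 3)}

/-! ### Joint analyticity of the slice derivatives and of the commutator -/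

section Analytic

/-- **Tool: the slice-gradient field of a jointly smooth, jointly analytic field on the open past is jointly analytic.**
`(t, x) ↦ D(w t)(x)` equals `D(uncurry w)(t, x) ∘ (0, ·)` there. [cite: LemarieRieusset2016, Thm. 9.12 (PDF p. 260)] -/
theorem analyticOnNhd_uncurry_fderiv_of_smooth {w : ℝ → EuclideanSpace ℝ (Fin 3) → EuclideanSpace ℝ (Fin 3)}
    (hsm : IsSmoothSpaceTimeOn (Iio (0 : ℝ)) w)
    (han : AnalyticOnNhd ℝ (uncurry w) (Iio (0 : ℝ) ×ˢ univ)) :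
    AnalyticOnNhd ℝ (uncurry fun t x => fderiv ℝ (w t) x) (Iio (0 : ℝ) ×ˢ univ) := by
  set Φ : (ℝ × EuclideanSpace ℝ (Fin 3) →L[ℝ] EuclideanSpace ℝ (Fin 3)) →L[ℝ]
      (EuclideanSpace ℝ (Fin 3) →L[ℝ] EuclideanSpace ℝ (Fin 3)) :=
    (ContinuousLinearMap.compL ℝ (EuclideanSpace ℝ (Fin 3)) (ℝ × EuclideanSpace ℝ (Fin 3))
      (EuclideanSpace ℝ (Fin 3))).flip (ContinuousLinearMap.inr ℝ ℝ (EuclideanSpace ℝ (Fin 3))) with hΦ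
  have hΦapply : ∀ L : ℝ × EuclideanSpace ℝ (Fin 3) →L[ℝ] EuclideanSpace ℝ (Fin 3),
      Φ L = L.comp (ContinuousLinearMap.inr ℝ ℝ (EuclideanSpace ℝ (Fin 3))) := by
    intro L
    simp [hΦ]
  have h1 : AnalyticOnNhd ℝ (fun z => Φ (fderiv ℝ (uncurry w) z)) (Iio (0 : ℝ) ×ˢ univ) :=
    Φ.comp_analyticOnNhd han.fderiv
  refine h1.congr (isOpen_Iio.prod isOpen_univ) ?_
  rintro ⟨t, x⟩ ⟨ht, -⟩
  change Φ (fderiv ℝ (uncurry w) (t, x)) = fderiv ℝ (w t) x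
  rw [hΦapply, hsm.fderiv_slice_of_isOpen isOpen_Iio ht x]

/-- The class is jointly real-analytic on the open past (Literature `IsTypeIAncientMild.analyticAt_uncurry`, set form).
[cite: LemarieRieusset2016, Thm. 9.12 (PDF p. 260)] -/
theorem analyticOnNhd_uncurry (hW : IsTypeIAncientMild C W) :
    AnalyticOnNhd ℝ (uncurry W) (Iio (0 : ℝ) ×ˢ univ) := by
  rintro ⟨t, x⟩ ⟨ht, -⟩
  exact hW.analyticAt_uncurry ht x

/-- The slice-gradient field `(t, x) ↦ D(W t)(x)` of a member of the class is jointly real-analytic.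
[cite: LemarieRieusset2016, Thm. 9.12 (PDF p. 260)] -/
theorem analyticOnNhd_uncurry_fderiv (hW : IsTypeIAncientMild C W) :
    AnalyticOnNhd ℝ (uncurry fun t x => fderiv ℝ (W t) x) (Iio (0 : ℝ) ×ˢ univ) :=
  analyticOnNhd_uncurry_fderiv_of_smooth hW.contDiffOn (analyticOnNhd_uncurry hW)

/-- The vorticity field `(t, x) ↦ curl W t x` of a member of the class is jointly smooth on the open past. [folklore] -/
theorem isSmoothSpaceTimeOn_curl (hW : IsTypeIAncientMild C W) :
    IsSmoothSpaceTimeOn (Iio (0 : ℝ)) fun t x => curl (W t) x :=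
by
  have hsm : IsSmoothSpaceTimeOn (Iio (0 : ℝ)) W := hW.contDiffOn
  exact (hsm.isSmoothSpaceTimeOn_fderiv_of_isOpen isOpen_Iio).clm
    (curlCLM : (EuclideanSpace ℝ (Fin 3) →L[ℝ] EuclideanSpace ℝ (Fin 3)) →L[ℝ] EuclideanSpace ℝ (Fin 3))

/-- The vorticity field `(t, x) ↦ curl W t x` of a member of the class is jointly real-analytic.
[cite: LemarieRieusset2016, Thm. 9.12 (PDF p. 260)] -/
theorem analyticOnNhd_uncurry_curl (hW : IsTypeIAncientMild C W) :
    AnalyticOnNhd ℝ (uncurry fun t x => curl (W t) x) (Iio (0 : ℝ) ×ˢ univ) :=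
  (curlCLM : (EuclideanSpace ℝ (Fin 3) →L[ℝ] EuclideanSpace ℝ (Fin 3)) →L[ℝ]
    EuclideanSpace ℝ (Fin 3)).comp_analyticOnNhd (analyticOnNhd_uncurry_fderiv hW)

/-- The vorticity-gradient field `(t, x) ↦ D(curl W t)(x)` of a member of the class is jointly real-analytic.
[cite: LemarieRieusset2016, Thm. 9.12 (PDF p. 260)] -/
theorem analyticOnNhd_uncurry_fderiv_curl (hW : IsTypeIAncientMild C W) :
    AnalyticOnNhd ℝ (uncurry fun t x => fderiv ℝ (curl (W t)) x) (Iio (0 : ℝ) ×ˢ univ) :=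
  analyticOnNhd_uncurry_fderiv_of_smooth (isSmoothSpaceTimeOn_curl hW) (analyticOnNhd_uncurry_curl hW)

/-- **The curl of the Lamb vector, `(t, x) ↦ D(curl W t)(x)[W t x] − D(W t)(x)[curl W t x] = (W·∇)ω − (ω·∇)W`, of a
member of the class is jointly real-analytic on the open past.** [cite: LemarieRieusset2016, Thm. 9.12 (PDF p. 260)] -/
theorem analyticOnNhd_uncurry_lambCurl (hW : IsTypeIAncientMild C W) :
    AnalyticOnNhd ℝ (uncurry fun t x =>
      fderiv ℝ (curl (W t)) x (W t x) - fderiv ℝ (W t) x (curl (W t) x)) (Iio (0 : ℝ) ×ˢ univ) := by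
  intro z hz
  set ev : (EuclideanSpace ℝ (Fin 3) →L[ℝ] EuclideanSpace ℝ (Fin 3)) →L[ℝ]
      EuclideanSpace ℝ (Fin 3) →L[ℝ] EuclideanSpace ℝ (Fin 3) :=
    ContinuousLinearMap.id ℝ (EuclideanSpace ℝ (Fin 3) →L[ℝ] EuclideanSpace ℝ (Fin 3)) with hev
  have h0 : AnalyticAt ℝ (uncurry W) z := analyticOnNhd_uncurry hW z hz
  have h1 : AnalyticAt ℝ (uncurry fun t x => fderiv ℝ (W t) x) z := analyticOnNhd_uncurry_fderiv hW z hz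
  have h2 : AnalyticAt ℝ (uncurry fun t x => curl (W t) x) z := analyticOnNhd_uncurry_curl hW z hz
  have h3 : AnalyticAt ℝ (uncurry fun t x => fderiv ℝ (curl (W t)) x) z :=
    analyticOnNhd_uncurry_fderiv_curl hW z hz
  have hA : AnalyticAt ℝ (fun z : ℝ × EuclideanSpace ℝ (Fin 3) =>
      (uncurry (fun t x => fderiv ℝ (curl (W t)) x) z) (uncurry W z)) z :=
    (ev.analyticAt_bilinear _).comp₂ h3 h0
  have hB : AnalyticAt ℝ (fun z : ℝ × EuclideanSpace ℝ (Fin 3) =>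
      (uncurry (fun t x => fderiv ℝ (W t) x) z) (uncurry (fun t x => curl (W t) x) z)) z :=
    (ev.analyticAt_bilinear _).comp₂ h1 h2
  exact hA.sub hB

/-- The curl of the Lamb vector at a fixed point `x` is real-analytic in time on `(−∞, 0)`.
[cite: LemarieRieusset2016, Thm. 9.12 (PDF p. 260)] -/
theorem analyticOnNhd_lambCurl_time (hW : IsTypeIAncientMild C W) (x : EuclideanSpace ℝ (Fin 3)) :
    AnalyticOnNhd ℝ (fun τ : ℝ =>
      fderiv ℝ (curl (W τ)) x (W τ x) - fderiv ℝ (W τ) x (curl (W τ) x)) (Iio 0) := by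
  intro t ht
  have hj := analyticOnNhd_uncurry_lambCurl hW (t, x) ⟨ht, mem_univ _⟩
  have hι : AnalyticAt ℝ (fun σ : ℝ => ((σ, x) : ℝ × EuclideanSpace ℝ (Fin 3))) t :=
    analyticAt_id.prod analyticAt_const
  have h2 := hj.comp_of_eq hι rfl
  simpa only [Function.comp_def, Function.uncurry_apply_pair] using h2

end Analytic

/-! ### Vanishing on a final slab or on an open set spreads to the whole past; the kill -/

section Kill

/-- **Final slab → whole past.** If the curl of the Lamb vector vanishes on a final slab `(τ₀, 0) × ℝ³`, it
vanishes at every `s < 0` (identity theorem in time at each fixed `x`). [cite: LemarieRieusset2016, Thm. 9.12 (PDF p. 260)] -/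
theorem lambCurl_eq_zero_of_finalSlab (hW : IsTypeIAncientMild C W) {τ₀ : ℝ} (hτ₀ : τ₀ < 0)
    (h : ∀ t : ℝ, τ₀ < t → t < 0 → ∀ x,
      fderiv ℝ (curl (W t)) x (W t x) - fderiv ℝ (W t) x (curl (W t) x) = 0) :
    ∀ s < 0, ∀ x, fderiv ℝ (curl (W s)) x (W s x) - fderiv ℝ (W s) x (curl (W s) x) = 0 := by
  intro s hs x
  have han := analyticOnNhd_lambCurl_time hW x
  have hτ2 : τ₀ / 2 ∈ Iio (0 : ℝ) := by
    change τ₀ / 2 < 0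
    linarith
  have hev : (fun τ : ℝ => fderiv ℝ (curl (W τ)) x (W τ x) - fderiv ℝ (W τ) x (curl (W τ) x)) =ᶠ[𝓝 (τ₀ / 2)]
      0 := by
    filter_upwards [Ioo_mem_nhds (show τ₀ < τ₀ / 2 by linarith) (show τ₀ / 2 < 0 by linarith)] with τ hτ
    exact h τ hτ.1 hτ.2 x
  exact han.eqOn_zero_of_preconnected_of_eventuallyEq_zero (convex_Iio 0).isPreconnected hτ2 hev hs

/-- **Open set → whole past.** If the curl of the Lamb vector vanishes on a nonempty open space–time subset of the
open past, it vanishes at every `s < 0` (identity theorem for the jointly analytic commutator on the connected slab).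
[cite: LemarieRieusset2016, Thm. 9.12 (PDF p. 260)] -/
theorem lambCurl_eq_zero_of_isOpen (hW : IsTypeIAncientMild C W) {U : Set (ℝ × EuclideanSpace ℝ (Fin 3))}
    (hU : IsOpen U) (hUsub : U ⊆ Iio (0 : ℝ) ×ˢ univ) (hne : U.Nonempty)
    (h : ∀ z ∈ U, fderiv ℝ (curl (W z.1)) z.2 (W z.1 z.2) - fderiv ℝ (W z.1) z.2 (curl (W z.1) z.2) = 0) :
    ∀ s < 0, ∀ x, fderiv ℝ (curl (W s)) x (W s x) - fderiv ℝ (W s) x (curl (W s) x) = 0 := by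
  obtain ⟨z₀, hz₀⟩ := hne
  have han := analyticOnNhd_uncurry_lambCurl hW
  have hev : (uncurry fun t x => fderiv ℝ (curl (W t)) x (W t x) - fderiv ℝ (W t) x (curl (W t) x)) =ᶠ[𝓝 z₀]
      0 := by
    filter_upwards [hU.mem_nhds hz₀] with z hz
    rw [Pi.zero_apply, ← h z hz]
    rfl
  have hpre : IsPreconnected (Iio (0 : ℝ) ×ˢ (univ : Set (EuclideanSpace ℝ (Fin 3)))) :=
    (isPreconnected_Iio (a := (0 : ℝ))).prod isPreconnected_univ
  have key := han.eqOn_zero_of_preconnected_of_eventuallyEq_zero hpre (hUsub hz₀) hev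
  intro s hs x
  have hsx := key (mk_mem_prod (show s ∈ Iio (0 : ℝ) from hs) (mem_univ x))
  rw [Pi.zero_apply] at hsx
  exact hsx

/-- **THE KILL (generalised-Beltrami rigidity of the class, imported by name): a member of the class whose Lamb
vector is curl-free on a final slab is identically zero.** [cite: KochNadirashviliSereginSverak2009, §4 (arXiv:0709.3599 p. 8)] -/
theorem eq_zero_of_lambCurl_finalSlab (hW : IsTypeIAncientMild C W) {τ₀ : ℝ} (hτ₀ : τ₀ < 0)
    (h : ∀ t : ℝ, τ₀ < t → t < 0 → ∀ x,
      fderiv ℝ (curl (W t)) x (W t x) - fderiv ℝ (W t) x (curl (W t) x) = 0) :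
    ∀ t < 0, ∀ x, W t x = 0 :=
  eq_zero_of_convect_comm hW.hasTypeITimeDecay hW.continuousOn_uncurry
    (fun _ _ hst ht x => hW.mild_eq_heatExtension hst ht x) (fun _ ht => hW.isDivFree ht)
    fun s hs y => by
      rw [convect_apply, convect_apply]
      exact sub_eq_zero.1 (lambCurl_eq_zero_of_finalSlab hW hτ₀ h s hs y)

/-- **A member of the class whose Lamb vector is curl-free on a nonempty open space–time set is identically zero.**
[cite: KochNadirashviliSereginSverak2009, §4 (arXiv:0709.3599 p. 8)] -/
theorem eq_zero_of_lambCurl_isOpen (hW : IsTypeIAncientMild C W) {U : Set (ℝ × EuclideanSpace ℝ (Fin 3))}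
    (hU : IsOpen U) (hUsub : U ⊆ Iio (0 : ℝ) ×ˢ univ) (hne : U.Nonempty)
    (h : ∀ z ∈ U, fderiv ℝ (curl (W z.1)) z.2 (W z.1 z.2) - fderiv ℝ (W z.1) z.2 (curl (W z.1) z.2) = 0) :
    ∀ t < 0, ∀ x, W t x = 0 :=
  eq_zero_of_convect_comm hW.hasTypeITimeDecay hW.continuousOn_uncurry
    (fun _ _ hst ht x => hW.mild_eq_heatExtension hst ht x) (fun _ ht => hW.isDivFree ht)
    fun s hs y => by
      rw [convect_apply, convect_apply]
      exact sub_eq_zero.1 (lambCurl_eq_zero_of_isOpen hW hU hUsub hne h s hs y)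

/-- **Apex form of the kill**: a member of the class with `t²‖(W·∇)ω − (ω·∇)W‖ ≤ 0` on the final slab `(−1, 0) × ℝ³`
is not singular at the space–time origin. [cite: KochNadirashviliSereginSverak2009, §4 (arXiv:0709.3599 p. 8)] -/
theorem not_singular_of_lambCurlBound_finalSlab (hW : IsTypeIAncientMild C W)
    (h : ∀ t : ℝ, -1 < t → t < 0 → ∀ x,
      t ^ 2 * ‖fderiv ℝ (curl (W t)) x (W t x) - fderiv ℝ (W t) x (curl (W t) x)‖ ≤ 0) :
    ¬ (∀ r > 0, ∀ M : ℝ, ∃ t ∈ Ioo (-(r ^ 2)) (0 : ℝ),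
      ∃ x ∈ ball (0 : EuclideanSpace ℝ (Fin 3)) r, M < ‖W t x‖) := by
  have hzero : ∀ t : ℝ, -1 < t → t < 0 → ∀ x,
      fderiv ℝ (curl (W t)) x (W t x) - fderiv ℝ (W t) x (curl (W t) x) = 0 := by
    intro t h1 h2 x
    have ht2 : 0 < t ^ 2 := by nlinarith
    have hle := h t h1 h2 x
    have hn : ‖fderiv ℝ (curl (W t)) x (W t x) - fderiv ℝ (W t) x (curl (W t) x)‖ ≤ 0 := by
      by_contra hcon
      push Not at hcon
      have := mul_pos ht2 hcon
      linarith
    exact norm_le_zero_iff.1 hn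
  intro hsing
  obtain ⟨t, ht, x, -, hM⟩ := hsing 1 one_pos 0
  have h0 := eq_zero_of_lambCurl_finalSlab hW (τ₀ := -1) (by norm_num) hzero t ht.2 x
  rw [h0, norm_zero] at hM
  exact lt_irrefl _ hM

end Kill

/-! ### Scale covariance -/

section Scaling

/-- **Scale covariance of the curl of the Lamb vector**: `comm(W_c)(s, y) = c⁴ • comm(W)(c²s, cy)` for the parabolic
rescaling `W_c(s, y) = c • W(c²s, cy)`. [folklore] -/
theorem lambCurl_nsRescale (c : ℝ) (V : ℝ → EuclideanSpace ℝ (Fin 3) → EuclideanSpace ℝ (Fin 3)) (s : ℝ)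
    (y : EuclideanSpace ℝ (Fin 3)) :
    fderiv ℝ (curl (nsRescale c V s)) y (nsRescale c V s y) -
        fderiv ℝ (nsRescale c V s) y (curl (nsRescale c V s) y) =
      (c * c * c * c) • (fderiv ℝ (curl (V (c ^ 2 * s))) (c • y) (V (c ^ 2 * s) (c • y)) -
        fderiv ℝ (V (c ^ 2 * s)) (c • y) (curl (V (c ^ 2 * s)) (c • y))) := by
  have hcurl : curl (nsRescale c V s) y = (c * c) • curl (V (c ^ 2 * s)) (c • y) := by
    rw [curl_eq_curlCLM, fderiv_nsRescale, map_smul, ← curl_eq_curlCLM]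
  rw [hcurl, fderiv_curl_nsRescale, fderiv_nsRescale, nsRescale_apply, _root_.smul_apply, _root_.smul_apply,
    map_smul, map_smul, smul_smul, smul_smul, smul_sub]
  congr 1
  ring_nf

/-- **Scale covariance of the dimensionless bound `s²‖comm‖ ≤ θ`.** [folklore] -/
theorem lambCurlBound_at_nsRescale (V : ℝ → EuclideanSpace ℝ (Fin 3) → EuclideanSpace ℝ (Fin 3)) (θ : ℝ)
    {c s : ℝ} (y : EuclideanSpace ℝ (Fin 3)) (hc : 0 < c)
    (h : (c ^ 2 * s) ^ 2 * ‖fderiv ℝ (curl (V (c ^ 2 * s))) (c • y) (V (c ^ 2 * s) (c • y)) -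
        fderiv ℝ (V (c ^ 2 * s)) (c • y) (curl (V (c ^ 2 * s)) (c • y))‖ ≤ θ) :
    s ^ 2 * ‖fderiv ℝ (curl (nsRescale c V s)) y (nsRescale c V s y) -
        fderiv ℝ (nsRescale c V s) y (curl (nsRescale c V s) y)‖ ≤ θ := by
  rw [lambCurl_nsRescale, norm_smul, Real.norm_of_nonneg (by positivity : (0 : ℝ) ≤ c * c * c * c)]
  calc s ^ 2 * (c * c * c * c * ‖fderiv ℝ (curl (V (c ^ 2 * s))) (c • y) (V (c ^ 2 * s) (c • y)) -
          fderiv ℝ (V (c ^ 2 * s)) (c • y) (curl (V (c ^ 2 * s)) (c • y))‖)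
      = (c ^ 2 * s) ^ 2 * ‖fderiv ℝ (curl (V (c ^ 2 * s))) (c • y) (V (c ^ 2 * s) (c • y)) -
          fderiv ℝ (V (c ^ 2 * s)) (c • y) (curl (V (c ^ 2 * s)) (c • y))‖ := by ring
    _ ≤ θ := h

/-- **The dimensionless size `s²‖comm‖` is scale invariant** (equality form). [folklore] -/
theorem sq_mul_norm_lambCurl_nsRescale (V : ℝ → EuclideanSpace ℝ (Fin 3) → EuclideanSpace ℝ (Fin 3))
    {c : ℝ} (hc : 0 < c) (s : ℝ) (y : EuclideanSpace ℝ (Fin 3)) :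
    s ^ 2 * ‖fderiv ℝ (curl (nsRescale c V s)) y (nsRescale c V s y) -
        fderiv ℝ (nsRescale c V s) y (curl (nsRescale c V s) y)‖ =
      (c ^ 2 * s) ^ 2 * ‖fderiv ℝ (curl (V (c ^ 2 * s))) (c • y) (V (c ^ 2 * s) (c • y)) -
        fderiv ℝ (V (c ^ 2 * s)) (c • y) (curl (V (c ^ 2 * s)) (c • y))‖ := by
  rw [lambCurl_nsRescale, norm_smul, Real.norm_of_nonneg (by positivity : (0 : ℝ) ≤ c * c * c * c)]
  ring

end Scaling

end Summit.NavierStokesRegularity.NavierStokesRegularity.Theorems.FiniteDissipationLiouville.CaloricDefect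

end
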